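import Summits.ResolutionOfSingularities.ResolutionOfSingularities.Theorems.KFibre

/-!
# KThread — concrete compositum `K·B ⊆ L`, generic localisations, `K`-rationality (Layer C1-transport / C2 / C3 of the tower dictionary)

0-weight TOOL toward `TightDefectClasses.TowerDictionary` (decomp-res lens-5, g39; plan `NEXT-g40.md` §6).  Pure commutative algebra on top of `KFibre`.
Setting: fields `k ⊆ K ⊆ L` (`K/k` separable algebraic for §2), a `k`-subalgebra `B ≤ L` (the images `B_i` of the kernel-zero stalk chain), `E = B ⊗_k K`,
the multiplication map `μ : B ⊗_k K → L`, `b ⊗ a ↦ b·a`, whose image is the compositum `K·B`.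

* §1 `eq_zero_of_sum_mul_eq_zero_of_linearIndependent` — the elementwise form of `B`-linear independence (bridge from `LinDisjoint.linearIndependent_of_frac`);
  **`productMap_injective`** — if `K` is linearly disjoint from `B` over `k` (elementwise form), `μ : B ⊗_k K →ₐ[k] L` is INJECTIVE, so `K·B ≅ B ⊗_k K`
  (`AlgEquiv.ofInjective`) and every result of `KFibre` applies to the concrete compositum.
* §2 `map_comap_eq_maximalIdeal_of_isLocalization`, `mem_pow_maximalIdeal_iff_of_isLocalization` — `KFibre.map_comap_eq_maximalIdeal` /
  `KFibre.algebraMap_mem_pow_maximalIdeal_iff` for ARBITRARY localisations `[IsLocalization.AtPrime S 𝔮]`, `[IsLocalization.AtPrime S′ 𝔓]` (the dictionary's `B̃_i`,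
  `(B̃_i)_𝔔̃`, `B_i` itself are such, as subrings of `L′` — never the `Localization` type).
* §3 **`exists_sub_algebraMap_mem_maximalIdeal`** — `K`-RATIONALITY of a localisation at a `K`-rational maximal ideal: if `K → E/𝔴` is onto then every
  `w ∈ S = E_𝔴` is `≡ c (mod 𝔪_S)` for some `c ∈ K` — this is `FrameStep.frame_step`'s hypothesis `hrat` for `B′ = B̃_{i+1}`.

All PROVED, 0 sorry.  Sources: [ZariskiSamuel1958, Ch. III §15] (linear disjointness, free compositum); §2–§3 are formal transports of `KFibre` along the canonical
isomorphisms of localisations and folklore on local rings [Matsumura1987, §4].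
-/

noncomputable section

set_option linter.dupNamespace false

namespace Summit.ResolutionOfSingularities.ResolutionOfSingularities.Theorems.KThread

open TensorProduct IsLocalRing

/-! ## §1 The multiplication map `B ⊗_k K → L` is injective under linear disjointness -/

section Compositum

variable {k K L : Type} [Field k] [Field K] [Field L] [Algebra k K] [Algebra k L] [Algebra K L] [IsScalarTower k K L]

/-- Elementwise form of linear independence over a subring: if `v` is `B`-linearly independent (`B ≤ L` a subring acting by multiplication) and
`∑_{i ∈ s} c_i v_i = 0` with all `c_i ∈ B`, then all `c_i = 0`.  (Bridge from `LinDisjoint.linearIndependent_of_frac`.) -/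
theorem eq_zero_of_sum_mul_eq_zero_of_linearIndependent {ι : Type} (B : Subring L) (v : ι → L) (h : LinearIndependent B v)
    (s : Finset ι) (c : ι → L) (hc : ∀ i ∈ s, c i ∈ B) (hsum : ∑ i ∈ s, c i * v i = 0) : ∀ i ∈ s, c i = 0 := by
  classical
  intro i hi
  set g : ι → B := fun j => if hj : j ∈ s then ⟨c j, hc j hj⟩ else 0 with hg
  have hgs : ∑ j ∈ s, g j • v j = 0 := by
    rw [← hsum]
    refine Finset.sum_congr rfl fun j hj => ?_
    rw [hg]
    simp only [dif_pos hj, Subring.smul_def, smul_eq_mul]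
  have h0 := (linearIndependent_iff'.mp h) s g hgs i hi
  have : ((g i : B) : L) = c i := by rw [hg]; simp only [dif_pos hi]
  rw [← this, h0]
  rfl

/-- **The multiplication map `μ : B ⊗_k K → L`, `b ⊗ a ↦ b · a`, is injective** when `K` is linearly disjoint from the `k`-subalgebra `B ≤ L` in the
elementwise sense: every `k`-linearly independent family of `K` admits no non-trivial relation with coefficients in `B`.  (Expand in the `B`-basis
`1 ⊗ a_i` of `B ⊗_k K` given by a `k`-basis `(a_i)` of `K`.)  Hence `K·B = μ(B ⊗_k K) ≅ B ⊗_k K`. [cite: ZariskiSamuel1958, Ch. III §15] -/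
theorem productMap_injective (B : Subalgebra k L)
    (hind : ∀ (ι : Type) (s : Finset ι) (a : ι → K) (c : ι → L), LinearIndependent k a → (∀ i ∈ s, c i ∈ B) →
      ∑ i ∈ s, c i * algebraMap K L (a i) = 0 → ∀ i ∈ s, c i = 0) :
    Function.Injective (Algebra.TensorProduct.productMap B.val (IsScalarTower.toAlgHom k K L)) := by
  classical
  set μ := Algebra.TensorProduct.productMap B.val (IsScalarTower.toAlgHom k K L) with hμ
  set bK := Module.Basis.ofVectorSpace k K with hbK
  set bB := Algebra.TensorProduct.basis B bK with hbB
  rw [injective_iff_map_eq_zero]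
  intro x hx
  have hsum : μ x = ∑ i ∈ (bB.repr x).support, ((bB.repr x i : B) : L) * algebraMap K L (bK i) := by
    conv_lhs => rw [← bB.linearCombination_repr x, Finsupp.linearCombination_apply, Finsupp.sum, map_sum]
    refine Finset.sum_congr rfl fun i _ => ?_
    rw [hbB, Algebra.TensorProduct.basis_repr_symm_apply', hμ, Algebra.TensorProduct.productMap_apply_tmul]
    rfl
  have hzero : ∀ i ∈ (bB.repr x).support, ((bB.repr x i : B) : L) = 0 :=
    hind _ _ bK (fun i => ((bB.repr x i : B) : L)) bK.linearIndependent (fun i _ => (bB.repr x i).2)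
      (by rw [← hsum, hx])
  have hrepr : bB.repr x = 0 := by
    refine Finsupp.ext fun i => ?_
    rw [Finsupp.zero_apply]
    by_contra hne
    have h1 := hzero i (Finsupp.mem_support_iff.mpr hne)
    exact hne (Subtype.ext (h1.trans (ZeroMemClass.coe_zero B).symm))
  exact bB.repr.injective (by rw [hrepr, map_zero])

end Compositum

/-! ## §2 `KFibre` for arbitrary localisations -/

section Localisations

/-- Powers of the maximal ideal are matched by a ring isomorphism of local rings. -/
theorem mem_pow_maximalIdeal_iff_of_ringEquiv {R R' : Type} [CommRing R] [CommRing R'] [IsLocalRing R] [IsLocalRing R']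
    (f : R ≃+* R') (n : ℕ) (x : R) : x ∈ maximalIdeal R ^ n ↔ f x ∈ maximalIdeal R' ^ n := by
  have hle : ∀ {A A' : Type} [CommRing A] [CommRing A'] [IsLocalRing A] [IsLocalRing A'] (g : A ≃+* A') (m : ℕ) (y : A),
      y ∈ maximalIdeal A ^ m → g y ∈ maximalIdeal A' ^ m := by
    intro A A' _ _ _ _ g m y hy
    have hmap : (maximalIdeal A).map (g : A →+* A') ≤ maximalIdeal A' := by
      rw [Ideal.map_le_iff_le_comap]
      intro a ha
      rw [Ideal.mem_comap, IsLocalRing.mem_maximalIdeal, mem_nonunits_iff]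
      rw [IsLocalRing.mem_maximalIdeal, mem_nonunits_iff] at ha
      intro hu
      exact ha ((isUnit_map_iff g a).mp hu)
    have h1 : g y ∈ (maximalIdeal A ^ m).map (g : A →+* A') := Ideal.mem_map_of_mem _ hy
    rw [Ideal.map_pow] at h1
    exact Ideal.pow_right_mono hmap m h1
  refine ⟨hle f n x, fun h => ?_⟩
  have h2 := hle f.symm n (f x) h
  rwa [RingEquiv.symm_apply_apply] at h2

variable (k K : Type) [Field k] [Field K] [Algebra k K] [Algebra.IsSeparable k K] (B : Type) [CommRing B] [Algebra k B]

/-- `KFibre.map_comap_eq_maximalIdeal` for any localisation `S` of `E = B ⊗_k K` at the prime `𝔮`: `(𝔮 ∩ B)·S = 𝔪_S`. -/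
theorem map_comap_eq_maximalIdeal_of_isLocalization (𝔮 : Ideal (B ⊗[k] K)) [𝔮.IsPrime]
    (S : Type) [CommRing S] [Algebra (B ⊗[k] K) S] [IsLocalization.AtPrime S 𝔮] [IsLocalRing S] :
    (𝔮.comap (algebraMap B (B ⊗[k] K))).map ((algebraMap (B ⊗[k] K) S).comp (algebraMap B (B ⊗[k] K))) =
      maximalIdeal S := by
  set e : Localization.AtPrime 𝔮 ≃ₐ[B ⊗[k] K] S := IsLocalization.algEquiv 𝔮.primeCompl (Localization.AtPrime 𝔮) S with he
  have hcomp : (algebraMap (B ⊗[k] K) S) = (e : Localization.AtPrime 𝔮 →+* S).comp (algebraMap (B ⊗[k] K) (Localization.AtPrime 𝔮)) := by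
    refine RingHom.ext fun x => ?_
    change algebraMap (B ⊗[k] K) S x = e (algebraMap (B ⊗[k] K) (Localization.AtPrime 𝔮) x)
    exact (e.commutes x).symm
  have h1 := KFibre.map_comap_eq_maximalIdeal k K B 𝔮
  rw [IsScalarTower.algebraMap_eq B (B ⊗[k] K) (Localization.AtPrime 𝔮), ← Ideal.map_map] at h1
  rw [hcomp, RingHom.comp_assoc, ← Ideal.map_map, ← Ideal.map_map, h1,
    ← Localization.AtPrime.map_eq_maximalIdeal, Ideal.map_map, ← hcomp,
    IsLocalization.AtPrime.map_eq_maximalIdeal 𝔮 S]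

/-- `KFibre.algebraMap_mem_pow_maximalIdeal_iff` for any localisations: `S′` of `B` at `𝔓 = 𝔮 ∩ B` and `S` of `E = B ⊗_k K` at `𝔮`.  For `b ∈ B`:
`b ∈ 𝔪_{S′}^n ↔ b ∈ 𝔪_S^n`, i.e. `𝔮^(n) ∩ B = 𝔓^(n)`. -/
theorem mem_pow_maximalIdeal_iff_of_isLocalization (𝔮 : Ideal (B ⊗[k] K)) [𝔮.IsPrime] (n : ℕ) (b : B)
    (S' : Type) [CommRing S'] [Algebra B S'] [IsLocalization.AtPrime S' (𝔮.comap (algebraMap B (B ⊗[k] K)))] [IsLocalRing S']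
    (S : Type) [CommRing S] [Algebra (B ⊗[k] K) S] [IsLocalization.AtPrime S 𝔮] [IsLocalRing S] :
    algebraMap B S' b ∈ maximalIdeal S' ^ n ↔ algebraMap (B ⊗[k] K) S (algebraMap B (B ⊗[k] K) b) ∈ maximalIdeal S ^ n := by
  have key := KFibre.algebraMap_mem_pow_maximalIdeal_iff k K B 𝔮 n b
  set e' := IsLocalization.algEquiv (𝔮.comap (algebraMap B (B ⊗[k] K))).primeCompl
    (Localization.AtPrime (𝔮.comap (algebraMap B (B ⊗[k] K)))) S' with he'
  set e := IsLocalization.algEquiv 𝔮.primeCompl (Localization.AtPrime 𝔮) S with he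
  have hl := mem_pow_maximalIdeal_iff_of_ringEquiv e'.toRingEquiv n
    (algebraMap B (Localization.AtPrime (𝔮.comap (algebraMap B (B ⊗[k] K)))) b)
  have hr := mem_pow_maximalIdeal_iff_of_ringEquiv e.toRingEquiv n (algebraMap B (Localization.AtPrime 𝔮) b)
  have hl' : e'.toRingEquiv (algebraMap B (Localization.AtPrime (𝔮.comap (algebraMap B (B ⊗[k] K)))) b) = algebraMap B S' b :=
    e'.commutes b
  have hr' : e.toRingEquiv (algebraMap B (Localization.AtPrime 𝔮) b) = algebraMap (B ⊗[k] K) S (algebraMap B (B ⊗[k] K) b) := by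
    rw [IsScalarTower.algebraMap_apply B (B ⊗[k] K) (Localization.AtPrime 𝔮)]
    exact e.commutes _
  rw [hl'] at hl
  rw [hr'] at hr
  rw [← hl, ← hr, key]

end Localisations

/-! ## §3 `K`-rationality of the localisation at a `K`-rational maximal ideal -/

section Rational

variable {K E : Type} [Field K] [CommRing E] [Algebra K E]

/-- **`K`-rationality** (`FrameStep.frame_step`'s `hrat`).  Let `𝔴` be a maximal ideal of the `K`-algebra `E` with `K → E/𝔴` onto (a `K`-rational point —
e.g. `E/𝔪_B E` integral over `K = k̄`, `IsAlgClosed.algebraMap_bijective_of_isIntegral`), and `S` a localisation of `E` at `𝔴`.  Then every `w ∈ S` is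
congruent to a scalar: `∃ c ∈ K, w - c ∈ 𝔪_S`. [folklore] -/
theorem exists_sub_algebraMap_mem_maximalIdeal (𝔴 : Ideal E) [𝔴.IsMaximal]
    (hK : Function.Surjective (algebraMap K (E ⧸ 𝔴)))
    (S : Type) [CommRing S] [Algebra E S] [IsLocalization.AtPrime S 𝔴] [IsLocalRing S] [Algebra K S] [IsScalarTower K E S]
    (w : S) : ∃ c : K, w - algebraMap K S c ∈ maximalIdeal S := by
  obtain ⟨⟨y, z⟩, hyz⟩ := IsLocalization.mk'_surjective 𝔴.primeCompl w
  simp only at hyz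
  obtain ⟨a, ha⟩ := hK (Ideal.Quotient.mk 𝔴 y)
  obtain ⟨b, hb⟩ := hK (Ideal.Quotient.mk 𝔴 (z : E))
  have hz : (z : E) ∉ 𝔴 := z.2
  have hb0 : b ≠ 0 := by
    rintro rfl
    rw [map_zero, eq_comm, Ideal.Quotient.eq_zero_iff_mem] at hb
    exact hz hb
  refine ⟨a / b, ?_⟩
  -- `z·b` becomes a unit in `S`; multiply through
  have hzu : IsUnit (algebraMap E S (z : E)) := IsLocalization.map_units S z
  have hbu : IsUnit (algebraMap K S b) := (Ne.isUnit hb0).map _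
  have hkey : algebraMap E S (y * algebraMap K E b - (z : E) * algebraMap K E a) ∈ maximalIdeal S := by
    rw [IsLocalization.AtPrime.to_map_mem_maximal_iff S 𝔴, ← Ideal.Quotient.eq_zero_iff_mem]
    rw [map_sub, map_mul, map_mul, Ideal.Quotient.mk_algebraMap, Ideal.Quotient.mk_algebraMap, ← ha, ← hb]
    ring
  -- `w - a/b = (z b)⁻¹ · (y b - z a)` in `S`
  have hw : w - algebraMap K S (a / b) =
      (hzu.unit⁻¹ : Sˣ) * (hbu.unit⁻¹ : Sˣ) * algebraMap E S (y * algebraMap K E b - (z : E) * algebraMap K E a) := by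
    have h1 : w * algebraMap E S (z : E) = algebraMap E S y := by
      rw [← hyz, IsLocalization.mk'_spec]
    have h2 : algebraMap K S (a / b) * algebraMap K S b = algebraMap K S a := by
      rw [← map_mul, div_mul_cancel₀ a hb0]
    rw [map_sub, map_mul, map_mul, ← IsScalarTower.algebraMap_apply, ← IsScalarTower.algebraMap_apply]
    apply hzu.mul_left_cancel
    apply hbu.mul_left_cancel
    rw [show algebraMap K S b * (algebraMap E S (z : E) * (w - algebraMap K S (a / b))) =
        (w * algebraMap E S (z : E)) * algebraMap K S b - (algebraMap K S (a / b) * algebraMap K S b) * algebraMap E S (z : E) by ring,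
      h1, h2]
    rw [show algebraMap K S b * (algebraMap E S (z : E) * (↑hzu.unit⁻¹ * ↑hbu.unit⁻¹ *
        (algebraMap E S y * algebraMap K S b - algebraMap E S (z : E) * algebraMap K S a))) =
        (algebraMap E S (z : E) * ↑hzu.unit⁻¹) * (algebraMap K S b * ↑hbu.unit⁻¹) *
        (algebraMap E S y * algebraMap K S b - algebraMap E S (z : E) * algebraMap K S a) by ring]
    rw [IsUnit.mul_val_inv, IsUnit.mul_val_inv, one_mul, one_mul]
    ring
  rw [hw]
  exact Ideal.mul_mem_left _ _ hkey

end Rational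

end Summit.ResolutionOfSingularities.ResolutionOfSingularities.Theorems.KThread
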